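import Summits.QuantumFields.YangMills.Theorems.BalabanUVNodesPortS1JacCover
import Summits.QuantumFields.YangMills.Theorems.BalabanUVNodesPortS1JacobianHoloCovBlock

/-!
# NODE O port PT-A — ROW (e) OF `stub_LZjac`: (GI), PART 1 — THE INTEGER FORMULA `Ψ_jac` IS `SL(2,ℂ)`-GAUGE INVARIANT AS A TOTAL FUNCTION (the `IntLocalFormula.isGaugeInv` field): covariance of
# the integer (0.4) model, the UNCONDITIONAL block law `A₁^ℤ(ĉ)(𝐕^u) = Ad^ℂ(u(embZ ĉ₋)) · A₁^ℤ(ĉ)(𝐕) · Ad^ℂ(adj u(b₀(ĉ)₋))` in trace-projected coordinates, and `J_ℤ(ĉ, 𝐔^u) = J_ℤ(ĉ, 𝐔)`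

Cell `ym-nodeO-ideate`, porter seat `ymgap-nodeO-port-PTA-1` (gen 6); `--supports stmt-QuantumFields-27930` (helper); objects ✓ `…PortS1JacPiecesDefs`, two-block locality ✓ `…PortS1JacCover`,
the `2 × 2` adjugate ∕ `su2CoordC` algebra of gen 5 (✓ `…JacobianHoloCov`, `…HoloSL2`, `…HoloGauge`, `…HoloCovBlock`).  [I] = [Balaban1987RG1].  Print: (1.19) p.263 «invariant with respect to
Gᶜ-valued gauge transformations», (1.10) p.262, (2.16) p.269.
WHY UNCONDITIONAL.  `IntFormula.IsGaugeInv` asks invariance for EVERY configuration, junk values included.  Two devices make it hold: (i) `fderiv` is conjugated through LINEAR EQUIVALENCES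
without differentiability hypotheses (`fderiv_conj_of_comp_eq`: the chain rule where differentiable, `0 = 0` where not — differentiability at `w` and at `T w` are equivalent); (ii) the
coordinates are TRACE-PROJECTED (`su2CoordCt`), so conjugation acts on them through `Ad^ℂ` on all of `M₂(ℂ)` (`su2CoordCt_conj_eq_sum`), no tracelessness of the response needed.
* §1 `su2CoordCt_eq_su2CoordC_sub`, `su2CoordCt_of_trace_eq_zero`, linearity, ★ `su2CoordCt_conj_eq_sum`, `adMatCt_eq_adMatC`, `det_adMatCt_of_det_eq_one`, `sum_su2CoordCt_smul_su2Gen`.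
* §2 ★ `holMhZ_gauge_walkZ` (telescoping), `loopMhZ_gauge`, `embZ_add_e`, `axialMhZ_gauge`, `corrMhZ_gauge` (`ExpMeanLog.eml_conj`), ★★ `avgMhZ_gauge`, ★★ `iterMhZ_gauge` (gauge read at `embZ^[k]`).
PART 1 (this file): §1 coordinates, §2 covariance of the integer model.  PART 2 (`…JacIntGaugeBlock`): §3 the block law, §4 `isGaugeInv_ΨjacRaw`.

HONEST FRAMING.  Algebra ∕ calculus over the tree's own (0.4) model; NOTHING of Bałaban's estimates asserted, ported or discharged; `stub_LZjac` OPEN; 27930 OPEN · no claim; K0⁷∕K-Ax OPEN;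
NODE O 0∕1; COUNT 8∕28 · K 1∕4 UNMOVED; finite `𝕋⁴_{L^K}` at fixed ε — NOT continuum ∕ OS ∕ Clay; **the Yang–Mills mass gap is NOT proved by any of this.**  No `sorry`, no `def`, no `instance`,
no `notation`; standard axioms.
-/

noncomputable section

open scoped BigOperators Matrix.Norms.L2Operator Topology

namespace Summit.QuantumFields.YangMills.Theorems.BalabanUVNodesPortS1

open Summit.QuantumFields.YangMills.Theorems.K0RecordFormatNames
open Literature.MathematicalPhysics.QuantumFieldTheory.Balaban1983to89
open Literature.MathematicalPhysics.QuantumFieldTheory.Balaban1983to89.Node00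
open Literature.MathematicalPhysics.QuantumFieldTheory.Balaban1983to89.T4Continuum (T4Family Letter LStep loopWord)
open Literature.MathematicalPhysics.QuantumFieldTheory.Balaban1983to89.B7Prop1Explicit (e e_apply disp disp_cons disp_nil disp_replicate Letter.vec_true Letter.vec_false)
open Literature.MathematicalPhysics.QuantumFieldTheory.Balaban1983to89.BlockAveragingZd (IdxZ offZ disp_loopWord)
open Literature.MathematicalPhysics.QuantumFieldTheory.Balaban1983to89.ExpMeanLog (eml eml_conj)
open Literature.MathematicalPhysics.QuantumLattice (blockMap blockSites mem_blockSites_iff)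
open _root_.Matrix

/-! ## §1  Trace-projected coordinates: linearity, the trace projection, conjugation on ALL of `M₂(ℂ)` -/

section Coord

/-- `su2CoordCt M = su2CoordC (M − ½(tr M)·1)` (the trace projection). [folklore] -/
theorem su2CoordCt_eq_su2CoordC_sub (M : MatA 2) : su2CoordCt M = su2CoordC (M - (M.trace / 2) • (1 : MatA 2)) := by
  funext i
  fin_cases i
  · simp [su2CoordCt, su2CoordC]
  · simp [su2CoordCt, su2CoordC]
  · simp [su2CoordCt, su2CoordC, Matrix.trace_fin_two]
    ring

/-- On traceless matrices the projected coordinates are gen 5's `su2CoordC`. [folklore] -/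
theorem su2CoordCt_of_trace_eq_zero {M : MatA 2} (hM : M.trace = 0) : su2CoordCt M = su2CoordC M := by
  rw [su2CoordCt_eq_su2CoordC_sub, hM, zero_div, zero_smul, sub_zero]

/-- `su2CoordCt` is additive. [folklore] -/
theorem su2CoordCt_add (M N : MatA 2) (i : Fin 3) : su2CoordCt (M + N) i = su2CoordCt M i + su2CoordCt N i := by
  fin_cases i <;> simp [su2CoordCt] <;> ring

/-- `su2CoordCt` is ℂ-homogeneous. [folklore] -/
theorem su2CoordCt_smul (z : ℂ) (M : MatA 2) (i : Fin 3) : su2CoordCt (z • M) i = z * su2CoordCt M i := by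
  fin_cases i <;> simp [su2CoordCt] <;> ring

/-- `su2CoordCt` of a finite combination. [folklore] -/
theorem su2CoordCt_sum_smul {ι : Type*} (s : Finset ι) (N : ι → MatA 2) (z : ι → ℂ) (i : Fin 3) :
    su2CoordCt (∑ a ∈ s, z a • N a) i = ∑ a ∈ s, z a * su2CoordCt (N a) i := by
  classical
  induction s using Finset.induction_on with
  | empty => fin_cases i <;> simp [su2CoordCt]
  | insert a s ha ih => rw [Finset.sum_insert ha, Finset.sum_insert ha, su2CoordCt_add, su2CoordCt_smul, ih]

/-- `su2CoordCt` of a right-multiplied finite combination: `su2CoordCt ((Σ z_a • N_a) · A)_i = Σ z_a · su2CoordCt (N_a · A)_i`. [folklore] -/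
theorem su2CoordCt_sum_smul_mul {ι : Type*} (s : Finset ι) (N : ι → MatA 2) (z : ι → ℂ) (A : MatA 2) (i : Fin 3) :
    su2CoordCt ((∑ a ∈ s, z a • N a) * A) i = ∑ a ∈ s, z a * su2CoordCt (N a * A) i := by
  rw [Finset.sum_mul]
  simp_rw [smul_mul_assoc]
  exact su2CoordCt_sum_smul s _ z i

/-- Conjugation by a det-one matrix preserves the trace (`adj g · g = 1`). [folklore] -/
theorem trace_mul_mul_adjugate {g : MatA 2} (hg : g.det = 1) (M : MatA 2) : (g * M * g.adjugate).trace = M.trace := by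
  rw [Matrix.trace_mul_cycle, adjugate_mul_self_of_det_eq_one hg, one_mul]

/-- ★ **CONJUGATION IN TRACE-PROJECTED COORDINATES, FOR EVERY `M ∈ M₂(ℂ)`**: `su2CoordCt(g·M·adj g)_i = Σ_j su2CoordCt(g·su2Gen j·adj g)_i · su2CoordCt(M)_j` for det-one `g` (the projection
commutes with `Ad(g)`, which fixes `1` and preserves the trace). [cite: Balaban1987RG1, (2.16) p.269, (1.10) p.262] -/
theorem su2CoordCt_conj_eq_sum {g : MatA 2} (hg : g.det = 1) (M : MatA 2) (i : Fin 3) :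
    su2CoordCt (g * M * g.adjugate) i = ∑ j', su2CoordCt (g * su2Gen j' * g.adjugate) i * su2CoordCt M j' := by
  set M' : MatA 2 := M - (M.trace / 2) • (1 : MatA 2) with hM'def
  have hM' : M'.trace = 0 := by
    rw [hM'def, Matrix.trace_sub, Matrix.trace_smul, Matrix.trace_one, Fintype.card_fin]
    simp only [smul_eq_mul]
    push_cast
    ring
  have hconj : g * M * g.adjugate - ((g * M * g.adjugate).trace / 2) • (1 : MatA 2) = g * M' * g.adjugate := by
    rw [trace_mul_mul_adjugate hg, hM'def, mul_sub, sub_mul, Matrix.mul_smul, Matrix.smul_mul, mul_one, self_mul_adjugate_of_det_eq_one hg]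
  have hgen : ∀ j' : Fin 3, su2CoordCt (g * su2Gen j' * g.adjugate) = su2CoordC (g * su2Gen j' * g.adjugate) := fun j' =>
    su2CoordCt_of_trace_eq_zero (by rw [trace_mul_mul_adjugate hg, trace_su2Gen])
  rw [su2CoordCt_eq_su2CoordC_sub, hconj, su2CoordC_conj_eq_sum g hM' i]
  refine Finset.sum_congr rfl fun j' _ => ?_
  rw [hgen, su2CoordCt_eq_su2CoordC_sub M, ← hM'def]

/-- The projected adjoint matrix `Ad^ℂ(g)_{ia} = su2CoordCt(g·su2Gen a·adj g)_i` IS gen 5's `su2CoordC` adjoint matrix (its arguments are traceless). [folklore] -/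
theorem adMatCt_eq_adMatC {g : MatA 2} (hg : g.det = 1) :
    (Matrix.of fun i a : Fin 3 => su2CoordCt (g * su2Gen a * g.adjugate) i) = Matrix.of fun i a : Fin 3 => su2CoordC (g * su2Gen a * g.adjugate) i := by
  ext i a
  simp only [Matrix.of_apply]
  rw [su2CoordCt_of_trace_eq_zero (by rw [trace_mul_mul_adjugate hg, trace_su2Gen])]

/-- `det Ad^ℂ(g) = 1` at determinant one, projected edition. [folklore] -/
theorem det_adMatCt_of_det_eq_one {g : MatA 2} (hg : g.det = 1) : (Matrix.of fun i a : Fin 3 => su2CoordCt (g * su2Gen a * g.adjugate) i).det = 1 := by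
  rw [adMatCt_eq_adMatC hg, det_adMatC_of_det_eq_one hg]

/-- A traceless matrix is the `su2Gen`-combination of its projected coordinates. [folklore] -/
theorem sum_su2CoordCt_smul_su2Gen {M : MatA 2} (hM : M.trace = 0) : ∑ a, su2CoordCt M a • su2Gen a = M := by
  rw [su2CoordCt_of_trace_eq_zero hM, sum_su2CoordC_smul_su2Gen hM]

end Coord

/-! ## §2  Covariance of the integer (0.4) model under det-one gauge transformations `𝐕 ↦ (b ↦ u(b₋)·𝐕(b)·adj u(b₊))` on `ℤ^d` -/

section Gauge

variable {d : ℕ}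

/-- `holMhZ V [] = 1`. [cite: Balaban1987RG1, (0.4) p.253 (bookkeeping)] -/
theorem holMhZ_nil (V : (Fin d → ℤ) × Fin d → MatA 2) : holMhZ V [] = 1 := by simp [holMhZ]

/-- `holMhZ V (s :: γ) = stepMhZ V s · holMhZ V γ`. [cite: Balaban1987RG1, (0.4) p.253 (bookkeeping)] -/
theorem holMhZ_cons (V : (Fin d → ℤ) × Fin d → MatA 2) (s : ((Fin d → ℤ) × Fin d) × Bool) (γ : List (((Fin d → ℤ) × Fin d) × Bool)) :
    holMhZ V (s :: γ) = stepMhZ V s * holMhZ V γ := by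
  simp [holMhZ]

/-- ★ **INTEGER WALK PRODUCTS ARE COVARIANT**: `holMhZ (𝐕^u) (walkZ x w) = u(x) · holMhZ 𝐕 (walkZ x w) · adj u(x + disp w)` for det-one `u` (telescoping; backward steps through `adj(ABC) = adj C·adj B·adj A`,
`adj adj = id`). [cite: Balaban1985Averaging, (8) p.18; Balaban1987RG1, (1.10) p.262] -/
theorem holMhZ_gauge_walkZ (u : (Fin d → ℤ) → MatA 2) (hu : ∀ z, (u z).det = 1) (V : (Fin d → ℤ) × Fin d → MatA 2) :
    ∀ (x : Fin d → ℤ) (w : List (Letter d)),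
      holMhZ (fun b => u b.1 * V b * (u (b.1 + e b.2)).adjugate) (walkZ x w) = u x * holMhZ V (walkZ x w) * (u (x + disp w)).adjugate
  | x, [] => by
    simp only [walkZ, holMhZ_nil, disp_nil, add_zero, mul_one]
    exact (self_mul_adjugate_of_det_eq_one (hu x)).symm
  | x, (μ, true) :: w => by
    rw [walkZ, holMhZ_cons, holMhZ_cons, holMhZ_gauge_walkZ u hu V (x + e μ) w, disp_cons, Letter.vec_true, ← add_assoc]
    simp only [stepMhZ, if_true]
    calc u x * V (x, μ) * (u (x + e μ)).adjugate * (u (x + e μ) * holMhZ V (walkZ (x + e μ) w) * (u (x + e μ + disp w)).adjugate)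
        = u x * V (x, μ) * ((u (x + e μ)).adjugate * u (x + e μ)) * holMhZ V (walkZ (x + e μ) w) * (u (x + e μ + disp w)).adjugate := by noncomm_ring
      _ = u x * (V (x, μ) * holMhZ V (walkZ (x + e μ) w)) * (u (x + e μ + disp w)).adjugate := by
        rw [adjugate_mul_self_of_det_eq_one (hu _), mul_one]; noncomm_ring
  | x, (μ, false) :: w => by
    have hus : x - e μ + e μ = x := sub_add_cancel x (e μ)
    have hend : x + (-e μ + disp w) = x - e μ + disp w := by abel
    rw [walkZ, holMhZ_cons, holMhZ_cons, holMhZ_gauge_walkZ u hu V (x - e μ) w, disp_cons, Letter.vec_false, hend]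
    simp only [stepMhZ, Bool.false_eq_true, if_false]
    rw [hus, Matrix.adjugate_mul_distrib, Matrix.adjugate_mul_distrib, adjugate_adjugate_two]
    calc u x * ((V (x - e μ, μ)).adjugate * (u (x - e μ)).adjugate) * (u (x - e μ) * holMhZ V (walkZ (x - e μ) w) * (u (x - e μ + disp w)).adjugate)
        = u x * (V (x - e μ, μ)).adjugate * ((u (x - e μ)).adjugate * u (x - e μ)) * holMhZ V (walkZ (x - e μ) w) * (u (x - e μ + disp w)).adjugate := by
          noncomm_ring
      _ = u x * ((V (x - e μ, μ)).adjugate * holMhZ V (walkZ (x - e μ) w)) * (u (x - e μ + disp w)).adjugate := by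
        rw [adjugate_mul_self_of_det_eq_one (hu _), mul_one]; noncomm_ring

/-- ★ **The integer loop matrices transform by conjugation with `u(embZ ĉ₋)`** (closed contours, `disp_loopWord`). [cite: Balaban1987RG1, (0.4) p.253, (0.6) p.253] -/
theorem loopMhZ_gauge {L : ℕ} (u : (Fin d → ℤ) → MatA 2) (hu : ∀ z, (u z).det = 1) (V : (Fin d → ℤ) × Fin d → MatA 2) (ĉ : (Fin d → ℤ) × Fin d) (i : IdxZ d L) :
    loopMhZ L (fun b => u b.1 * V b * (u (b.1 + e b.2)).adjugate) ĉ i = u (embZ L ĉ.1) * loopMhZ L V ĉ i * (u (embZ L ĉ.1)).adjugate := by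
  unfold loopMhZ
  rw [holMhZ_gauge_walkZ u hu V, disp_loopWord, add_zero]

/-- `embZ L (y + e_μ) = embZ L y + L·e_μ`. [cite: Balaban1987RG1, (0.1) p.252 (bookkeeping)] -/
theorem embZ_add_e (L : ℕ) (y : Fin d → ℤ) (μ : Fin d) : embZ L (y + e μ) = embZ L y + (L : ℤ) • e μ := by
  funext ν
  simp only [embZ, Pi.add_apply, Pi.smul_apply, e_apply, smul_eq_mul]
  by_cases h : ν = μ
  · subst h; simp; ring
  · simp [h]

/-- ★ **The integer straight segment transforms as `u(embZ ĉ₋)·(·)·adj u(embZ ĉ₊)`.** [cite: Balaban1987RG1, (0.4) p.253] -/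
theorem axialMhZ_gauge {L : ℕ} (u : (Fin d → ℤ) → MatA 2) (hu : ∀ z, (u z).det = 1) (V : (Fin d → ℤ) × Fin d → MatA 2) (ĉ : (Fin d → ℤ) × Fin d) :
    axialMhZ L (fun b => u b.1 * V b * (u (b.1 + e b.2)).adjugate) ĉ = u (embZ L ĉ.1) * axialMhZ L V ĉ * (u (embZ L (ĉ.1 + e ĉ.2))).adjugate := by
  unfold axialMhZ
  rw [holMhZ_gauge_walkZ u hu V, disp_replicate, Letter.vec_true, embZ_add_e]

/-- ★ **The integer correction factor transforms by conjugation with `u(embZ ĉ₋)`** (`ExpMeanLog.eml_conj`, no smallness condition). [cite: Balaban1987RG1, (0.6) p.253] -/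
theorem corrMhZ_gauge {L : ℕ} (u : (Fin d → ℤ) → MatA 2) (hu : ∀ z, (u z).det = 1) (V : (Fin d → ℤ) × Fin d → MatA 2) (ĉ : (Fin d → ℤ) × Fin d) :
    corrMhZ L (fun b => u b.1 * V b * (u (b.1 + e b.2)).adjugate) ĉ = u (embZ L ĉ.1) * corrMhZ L V ĉ * (u (embZ L ĉ.1)).adjugate := by
  unfold corrMhZ
  have hl : (fun i : IdxZ d L => loopMhZ L (fun b => u b.1 * V b * (u (b.1 + e b.2)).adjugate) ĉ i) =
      fun i => u (embZ L ĉ.1) * loopMhZ L V ĉ i * (u (embZ L ĉ.1)).adjugate := funext fun i => loopMhZ_gauge u hu V ĉ i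
  rw [hl]
  exact eml_conj (self_mul_adjugate_of_det_eq_one (hu _)) (adjugate_mul_self_of_det_eq_one (hu _)) _

/-- ★★ **THE INTEGER (0.4) AVERAGE IS COVARIANT**: `avgMhZ L (𝐕^u) ĉ = u(embZ ĉ₋) · avgMhZ L 𝐕 ĉ · adj u(embZ ĉ₊)` for det-one `u` and EVERY `𝐕`. [cite: Balaban1987RG1, (0.4) p.253, (1.10) p.262; Balaban1985Averaging, (11) p.19] -/
theorem avgMhZ_gauge {L : ℕ} (u : (Fin d → ℤ) → MatA 2) (hu : ∀ z, (u z).det = 1) (V : (Fin d → ℤ) × Fin d → MatA 2) (ĉ : (Fin d → ℤ) × Fin d) :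
    avgMhZ L (fun b => u b.1 * V b * (u (b.1 + e b.2)).adjugate) ĉ = u (embZ L ĉ.1) * avgMhZ L V ĉ * (u (embZ L (ĉ.1 + e ĉ.2))).adjugate := by
  show corrMhZ L _ ĉ * axialMhZ L _ ĉ = u (embZ L ĉ.1) * (corrMhZ L V ĉ * axialMhZ L V ĉ) * (u (embZ L (ĉ.1 + e ĉ.2))).adjugate
  rw [corrMhZ_gauge u hu V ĉ, axialMhZ_gauge u hu V ĉ]
  calc u (embZ L ĉ.1) * corrMhZ L V ĉ * (u (embZ L ĉ.1)).adjugate * (u (embZ L ĉ.1) * axialMhZ L V ĉ * (u (embZ L (ĉ.1 + e ĉ.2))).adjugate)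
      = u (embZ L ĉ.1) * corrMhZ L V ĉ * ((u (embZ L ĉ.1)).adjugate * u (embZ L ĉ.1)) * axialMhZ L V ĉ * (u (embZ L (ĉ.1 + e ĉ.2))).adjugate := by noncomm_ring
    _ = u (embZ L ĉ.1) * (corrMhZ L V ĉ * axialMhZ L V ĉ) * (u (embZ L (ĉ.1 + e ĉ.2))).adjugate := by
      rw [adjugate_mul_self_of_det_eq_one (hu _), mul_one]; noncomm_ring

/-- ★★ **THE INTEGER `k`-FOLD ITERATE IS COVARIANT**, with the gauge transformation read at the `k`-fold block centres `embZ^[k]`. [cite: Balaban1987RG1, (0.21) p.256, (1.10) p.262] -/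
theorem iterMhZ_gauge {L : ℕ} : ∀ (k : ℕ) (u : (Fin d → ℤ) → MatA 2), (∀ z, (u z).det = 1) → ∀ U : (Fin d → ℤ) × Fin d → MatA 2,
    iterMhZ L k (fun b => u b.1 * U b * (u (b.1 + e b.2)).adjugate) =
      fun b => u ((embZ L)^[k] b.1) * iterMhZ L k U b * (u ((embZ L)^[k] (b.1 + e b.2))).adjugate
  | 0, _, _, _ => rfl
  | k + 1, u, hu, U => by
    show avgMhZ L (iterMhZ L k (fun b => u b.1 * U b * (u (b.1 + e b.2)).adjugate)) = fun b => _ * avgMhZ L (iterMhZ L k U) b * _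
    rw [iterMhZ_gauge k u hu U]
    funext ĉ
    rw [avgMhZ_gauge (fun z => u ((embZ L)^[k] z)) (fun z => hu _) (iterMhZ L k U) ĉ, Function.iterate_succ_apply, Function.iterate_succ_apply]

end Gauge


end Summit.QuantumFields.YangMills.Theorems.BalabanUVNodesPortS1

end
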